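import Summits.QuantumFields.YangMills.Theorems.BalabanUVNodesN21AveragingOscillation
import Summits.QuantumFields.BalabanUV.T4Continuum.Support.MinimalActionHexDictionary
import Summits.QuantumFields.BalabanUV.T4Continuum.Support.SkeletonLattice
import Literature.MathematicalPhysics.QuantumFieldTheory.Balaban1983to89.B11Thm1
import HarnessLib

/-!
# Balaban UV nodes, N16 width lane (N07 → N16 in-edge), file 20: CAPTURE AT RUN ONE from the sup key

Explicit-unit helper of lineage `pub-ymgap-dag-n16-w1` (generation 7), keyed to K3⁸ `stmt-QuantumFields-27366`
(`SpineGivenEndpointR13SepCoPHV`, skeleton v6).  COUNT-NEUTRAL: no statement item is closed, no stub of the v6 skeleton is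
discharged, node N07 (the sup key = [Balaban1985Variational] Thm 1 (8)+(10), uniformly in the run index) and node N16 are NOT
discharged here.

## What is proved (sorry-free, classical axioms only)

* `hol_plaqWord_swap`, `exists_boxVec_repr` — kinematics (opposite orientation = inverse holonomy; every site is a stencil
  point `L•q + boxVec r₀ + 0•e_μ + 0•e_ν` of its block).
* `norm_plaq_sub_one_le_of_avg` — ONE AVERAGING STEP REVERSED on the small-field class: if `U ∈ sfClass d L N ρ 1`,
  `avgIter L U 1 ∈ sfClass d L N ε₁ 0`, `512(d+1)(d+4)ρ ≤ 1` and the covariant forward differences of the plaquette variables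
  of `U` are `≤ γ`, then every unit plaquette of `U` is within `(ε₁ + L²ω + 226θ²)∕L²` of `1`
  (`θ = 8(d+1)(d+4)ρ`, `L²ω = L²(2dL+4L)(γ + 2(3dL+8L)(ρ∕L²)²)`).  This is dag-n21-a's two-sided [Balaban1985Averaging] Prop. 1,
  `Summit.QuantumFields.YangMills.Theorems.N21AveragingOscillation.prop1_twoSided_of_covariantStep`, used BY NAME, plus the
  orientation swap and the block decomposition; no minimality is used.
* `mem_sfClass_one_of_avg` — the class form with the letter `γ = cε₁∕L³`:
  `U ∈ sfClass d L N (ε₁(1 + (2d+4)c) + K(d)ρ²) 1`, `K(d) = 2(2d+4)(3d+8) + 14464(d+1)²(d+4)²`, independent of `L`.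
* `capture_run_one_of_supKey` — for `C : B11Thm1.Consts` and the `k = 0` instance of this lane's supKey(C, c) hypothesis
  (files 17–19: `…N16SlotKeyOfSupData`, `…N16PinnedLooseMatchOfSupKey`), every run-1 minimiser over `sfClass (C.B₃ε₁) 1` at an
  `ε₁`-loose datum lies in `sfClass (ε₁(1+(2d+4)c) + K(d)(C.B₃ε₁)²) 1` — strictly inside `sfClass (C.B₃ε₁) 1` once
  `1 + (2d+4)c + K(d)C.B₃²ε₁ < C.B₃`.  So at run one the CAPTURE∕INTERIOR hypothesis of the lineage's file 7 is a consequence of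
  the sup key.  For runs `k+1 ≥ 2` the same argument needs the (10)-type letter for the intermediate averages `avgIter L U j`,
  `1 ≤ j ≤ k`, which supKey does not supply — not claimed.

Sources: [Balaban1985Averaging] Prop. 1, (44)–(51), pp. 24–26; [Balaban1985Variational] Thm 1 (8)–(10), p. 279.
-/

set_option autoImplicit false

open scoped BigOperators Matrix Matrix.Norms.L2Operator
open NormedSpace

namespace Summit.QuantumFields.YangMills.BalabanUVNodes.N16CaptureRunOne

open Literature.MathematicalPhysics.QuantumFieldTheory.Balaban1983to89
open B7Prop1Explicit B7Prop2Explicit MatrixLog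
open T4AveragingDeficitWall hiding Site Plane Plaq Bond
open Summit.QuantumFields.BalabanUV.T4Continuum
open AveragingDeficitTransport (mem_U1_of_unitary)
open MinimalActionSandwich (IsMinimiser)
open MinimalActionRate (sfClass)
open SkeletonLattice (cdiv cmod smul_cdiv_add_cmod cmod_nonneg cmod_lt)
open Summit.QuantumFields.YangMills.Theorems.N21AveragingOscillation (prop1_twoSided_of_covariantStep)

noncomputable section

variable {d : ℕ} {n : Type} [Fintype n] [DecidableEq n] [Nonempty n]

/-! ## §1 Kinematics: the two orientations of a plaquette; the block decomposition of a site -/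

omit [Fintype n] [DecidableEq n] [Nonempty n] in
/-- The oppositely oriented plaquette word from the same corner gives the inverse holonomy. [folklore] -/
theorem hol_plaqWord_swap {G : Type*} [Group G] (U : Site d → Fin d → G) (x : Site d) (κ κ' : Fin d) :
    hol U x (plaqWord κ' κ) = (hol U x (plaqWord κ κ'))⁻¹ := by
  simp only [plaqWord, hol_cons, hol_nil, mul_one, stepHol_true, stepHol_false, Letter.vec_true, Letter.vec_false,
    mul_inv_rev, inv_inv]
  have h1 : x + e κ' + e κ - e κ' = x + e κ := by abel
  have h4 : x + e κ + e κ' - e κ = x + e κ' := by abel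
  have h5 : x + e κ' + e κ + -e κ' - e κ = x := by abel
  have h6 : x + e κ + e κ' + -e κ - e κ' = x := by abel
  simp only [h1, h4, h5, h6, mul_assoc]

omit [Fintype n] [DecidableEq n] [Nonempty n] in
/-- Every site is a stencil point of the block of its coarse site: `x₀ = L•⌊x₀∕L⌋ + boxVec r₀ + 0·e_μ + 0·e_ν`. [folklore] -/
theorem exists_boxVec_repr {L : ℕ} (hL : 1 ≤ L) (x₀ : Site d) (μ ν : Fin d) :
    ∃ r₀ : Fin d → Fin L, x₀ = (L : ℤ) • cdiv L x₀ + boxVec L r₀ + ((0 : ℕ) : ℤ) • e μ + ((0 : ℕ) : ℤ) • e ν := by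
  refine ⟨fun i => ⟨(cmod L x₀ i).toNat, ?_⟩, ?_⟩
  · have h1 := cmod_lt hL x₀ i; have h2 := cmod_nonneg hL x₀ i; omega
  · have hb : boxVec L (fun i => ⟨(cmod L x₀ i).toNat, by have h1 := cmod_lt hL x₀ i; have h2 := cmod_nonneg hL x₀ i; omega⟩)
        = cmod L x₀ := by
      funext i; simp only [boxVec]; exact Int.toNat_of_nonneg (cmod_nonneg hL x₀ i)
    rw [hb, Nat.cast_zero, zero_smul, zero_smul, add_zero, add_zero, smul_cdiv_add_cmod]

/-! ## §2 ★ ONE AVERAGING STEP REVERSED on the small-field class: the plaquettes of a level-1 configuration from those of its average -/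

/-- ★★ **CAPTURE AT RUN ONE — THE PLAQUETTE BOUND** ([Balaban1985Averaging] Prop. 1 read in the REVERSE direction, dag-n21-a's
`N21AveragingOscillation.prop1_twoSided_of_covariantStep` BY NAME).  Let `U` lie in the level-1 class `sfClass d L N ρ 1` (`U(N)`-valued, `(N·L)`-periodic,
every unit plaquette within `ρ∕L²` of `1`, `512(d+1)(d+4)ρ ≤ 1`), let its one-step average `avgIter L U 1 = rescale L (bavg L U)` lie in `sfClass d L N ε₁ 0`
(every unit plaquette of the average within `ε₁` of `1`), and let the covariant forward differences of `U`'s plaquette variables obey `‖∇_U U(∂·)‖ ≤ γ`.  Then EVERY unit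
plaquette of `U` is within `(ε₁ + L²ω + 226θ²)∕L²` of `1`, `θ = 8(d+1)(d+4)ρ`, `L²ω = (2dL+4L)L²·(γ + 2(3dL+8L)(ρ∕L²)·(ρ∕L²))` — the datum's plaquette over `L²`
up to the oscillation and the second-order error.  No minimality is used. [cite: Balaban1985Averaging, Prop. 1 (44)–(51) pp.24–26] -/
theorem norm_plaq_sub_one_le_of_avg {L N : ℕ} (hL : 1 ≤ L) {ρ ε₁ γ : ℝ} (hρ : 0 ≤ ρ)
    (hsmall : 512 * (d + 1) * (d + 4) * ρ ≤ 1) {U : Site d → Fin d → (Matrix n n ℂ)ˣ}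
    (hU : U ∈ sfClass d L N ρ 1) (hV : avgIter L U 1 ∈ sfClass d L N ε₁ 0)
    (hγ : ∀ (x : Site d) (κ : Fin d) (π : T4AveragingDeficitWall.Plane d),
      ‖covGrad U (fun q => ((fhol U q : (Matrix n n ℂ)ˣ) : Matrix n n ℂ)) x κ π‖ ≤ γ)
    (x₀ : Site d) {κ κ' : Fin d} (hκκ' : κ ≠ κ') :
    ‖((hol U x₀ (plaqWord κ κ') : (Matrix n n ℂ)ˣ) : Matrix n n ℂ) - 1‖
      ≤ (ε₁ + ((L : ℝ) ^ 2 * (((2 * (d * L) + 4 * L : ℕ) : ℝ) * (γ + 2 * (((3 * (d * L) + 8 * L : ℕ) : ℝ) * (ρ / (L : ℝ) ^ 2)) * (ρ / (L : ℝ) ^ 2)))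
          + 226 * (8 * (d + 1) * (d + 4) * ρ) ^ 2)) / (L : ℝ) ^ 2 := by
  obtain ⟨hUu, -, hUs⟩ := hU
  obtain ⟨-, -, hVs⟩ := hV
  have hL0 : (0 : ℝ) < L := by exact_mod_cast (by omega : 0 < L)
  have hL2 : (0 : ℝ) < (L : ℝ) ^ 2 := by positivity
  have hV1 : ∀ x i, U x i ∈ U1 (Matrix n n ℂ) := fun x i => mem_U1_of_unitary (hUu x i)
  -- (44) at radius `α₀ = ρ / L²`
  have hα₀ : (0 : ℝ) ≤ ρ / (L : ℝ) ^ 2 := by positivity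
  have h44 : ∀ (x : Site d) (i i' : Fin d), i ≠ i' → ‖((hol U x (plaqWord i i') : (Matrix n n ℂ)ˣ) : Matrix n n ℂ) - 1‖ ≤ ρ / (L : ℝ) ^ 2 := by
    intro x i i' hii'; have := hUs x i i' hii'; simpa using this
  have hsmall' : 512 * (d + 1) * (d + 4) * (L : ℝ) ^ 2 * (ρ / (L : ℝ) ^ 2) ≤ 1 := by
    rw [show 512 * ((d : ℝ) + 1) * (d + 4) * (L : ℝ) ^ 2 * (ρ / (L : ℝ) ^ 2) = 512 * (d + 1) * (d + 4) * ρ by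
      field_simp]
    exact hsmall
  have hθ : 8 * ((d : ℝ) + 1) * (d + 4) * (L : ℝ) ^ 2 * (ρ / (L : ℝ) ^ 2) = 8 * (d + 1) * (d + 4) * ρ := by field_simp
  -- the datum's plaquettes: `‖V̄(∂p′) − 1‖ ≤ ε₁` at every coarse corner `L•q`
  have hcoarse : ∀ (q : Site d) (i i' : Fin d), i ≠ i' →
      ‖((cplaq L (bavg L U) ((L : ℤ) • q) i i' : (Matrix n n ℂ)ˣ) : Matrix n n ℂ) - 1‖ ≤ ε₁ := by
    intro q i i' hii'
    have h1 := hVs q i i' hii'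
    rw [avgIter_succ, avgIter_zero, hol_rescale_plaqWord] at h1
    simpa using h1
  -- WLOG the plane is positively ordered
  suffices key : ∀ (x : Site d) (i i' : Fin d), i < i' →
      ‖((hol U x (plaqWord i i') : (Matrix n n ℂ)ˣ) : Matrix n n ℂ) - 1‖
        ≤ (ε₁ + ((L : ℝ) ^ 2 * (((2 * (d * L) + 4 * L : ℕ) : ℝ) * (γ + 2 * (((3 * (d * L) + 8 * L : ℕ) : ℝ) * (ρ / (L : ℝ) ^ 2)) * (ρ / (L : ℝ) ^ 2)))
            + 226 * (8 * (d + 1) * (d + 4) * ρ) ^ 2)) / (L : ℝ) ^ 2 by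
    rcases lt_or_gt_of_ne hκκ' with h | h
    · exact key x₀ κ κ' h
    · rw [hol_plaqWord_swap U x₀ κ' κ]
      exact (norm_inv_sub_one_le (hol_mem hV1 _ _)).trans (key x₀ κ' κ h)
  intro x i i' hii'
  -- the covariant one-step bound in the plane `(i, i')`
  have hγ' : ∀ (y : Site d) (j : Fin d),
      ‖((U y j : (Matrix n n ℂ)ˣ) : Matrix n n ℂ) * ((hol U (y + e j) (plaqWord i i') : (Matrix n n ℂ)ˣ) : Matrix n n ℂ)
          * (((U y j)⁻¹ : (Matrix n n ℂ)ˣ) : Matrix n n ℂ) - ((hol U y (plaqWord i i') : (Matrix n n ℂ)ˣ) : Matrix n n ℂ)‖ ≤ γ :=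
    fun y j => hγ y j ⟨(i, i'), hii'⟩
  -- the block of `x`
  obtain ⟨r₀, hx⟩ := exists_boxVec_repr hL x i i'
  have hmain := (prop1_twoSided_of_covariantStep L hL ((L : ℤ) • cdiv L x) (ne_of_lt hii') U hV1 hα₀ hsmall' h44 hγ' r₀
    (i₀ := 0) (j₀ := 0) (by omega) (by omega)).1
  rw [← hx, hθ] at hmain
  rw [le_div_iff₀ hL2, mul_comm]
  exact hmain.trans (by linarith [hcoarse (cdiv L x) i i' (ne_of_lt hii')])

/-- ★★ **CAPTURE AT RUN ONE FROM THE SUP KEY's LETTER** (the class form): under the hypotheses of `norm_plaq_sub_one_le_of_avg` with the letter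
`γ = c·ε₁∕L³`, the level-1 configuration `U` lies in the class of radius `ε₁·(1 + (2d+4)c) + K(d)·ρ²` (scaled by `L⁻²` as `sfClass … 1` does), where
`K(d) = 2(2d+4)(3d+8) + 14464(d+1)²(d+4)²` — INDEPENDENT of `L`; with `ρ = B₃ε₁` and `B₃ > 1 + (2d+4)c + K(d)B₃²ε₁` this is a class STRICTLY inside
`sfClass (B₃ε₁) 1`: the INTERIOR∕CAPTURE property of the lineage's file 7 at run one, for every ADMISSIBLE level-1 configuration at an `ε₁`-loose datum
carrying the (10)-type letter (in particular for the run-1 minimisers under supKey).  Deeper runs need the letter for the intermediate averages.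
[cite: Balaban1985Averaging, Prop. 1 (44)–(51) pp.24–26] -/
theorem mem_sfClass_one_of_avg {L N : ℕ} (hL : 1 ≤ L) {ρ ε₁ c : ℝ} (hρ : 0 ≤ ρ)
    (hsmall : 512 * (d + 1) * (d + 4) * ρ ≤ 1) {U : Site d → Fin d → (Matrix n n ℂ)ˣ}
    (hU : U ∈ sfClass d L N ρ 1) (hV : avgIter L U 1 ∈ sfClass d L N ε₁ 0)
    (hγ : ∀ (x : Site d) (κ : Fin d) (π : T4AveragingDeficitWall.Plane d),
      ‖covGrad U (fun q => ((fhol U q : (Matrix n n ℂ)ˣ) : Matrix n n ℂ)) x κ π‖ ≤ c * ε₁ / (L : ℝ) ^ 3) :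
    U ∈ sfClass d L N (ε₁ * (1 + (2 * d + 4) * c) + (2 * (2 * d + 4) * (3 * d + 8) + 14464 * (d + 1) ^ 2 * (d + 4) ^ 2) * ρ ^ 2) 1 := by
  obtain ⟨hUu, hUp, hUs⟩ := hU
  refine ⟨hUu, hUp, fun x₀ κ κ' hκκ' => ?_⟩
  have hL0 : (0 : ℝ) < L := by exact_mod_cast (by omega : 0 < L)
  have hL1 : (1 : ℝ) ≤ L := by exact_mod_cast hL
  have h := norm_plaq_sub_one_le_of_avg hL hρ hsmall ⟨hUu, hUp, hUs⟩ hV hγ x₀ hκκ'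
  refine h.trans ?_
  rw [show ((L : ℝ) ^ 1) ^ 2 = (L : ℝ) ^ 2 by ring]
  refine div_le_div_of_nonneg_right ?_ (by positivity)
  -- arithmetic: `L²ω + 226θ² ≤ (2d+4)cε₁ + K(d)ρ²`
  have e1 : (L : ℝ) ^ 2 * (((2 * (d * L) + 4 * L : ℕ) : ℝ) * (c * ε₁ / (L : ℝ) ^ 3
        + 2 * (((3 * (d * L) + 8 * L : ℕ) : ℝ) * (ρ / (L : ℝ) ^ 2)) * (ρ / (L : ℝ) ^ 2)))
      = (2 * d + 4) * c * ε₁ + 2 * (2 * d + 4) * (3 * d + 8) * ρ ^ 2 := by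
    push_cast
    field_simp
  rw [e1]
  nlinarith [sq_nonneg ρ, sq_nonneg ((d : ℝ) + 1)]

/-! ## §3 For the run-1 minimisers of the lineage's keys -/

/-- ★ **CAPTURE AT RUN ONE UNDER THE SUP KEY** (this lineage's files 17–19: node N07's debt in (8)+(10) currency): if every `(C.B₃ε₁)`-class minimiser of
run 1 at an `ε₁`-loose datum has covariant plaquette differences `≤ c·ε₁∕L³` (the `k = 0` instance of supKey(C, c)), `512(d+1)(d+4)C.B₃ε₁ ≤ 1`, then it lies in
the class of radius `ε₁(1 + (2d+4)c) + K(d)(C.B₃ε₁)²` — strictly inside `sfClass (C.B₃ε₁) 1` as soon as `1 + (2d+4)c + K(d)C.B₃²ε₁ < C.B₃`.  So at run one the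
CAPTURE hypothesis of file 7 (`LOCATED-N16-INTERIOR-IS-CAPTURE`) is a CONSEQUENCE of the sup key; for runs `k+1 ≥ 2` the same argument needs the (10)-type letter for the
intermediate averages `avgIter L U j`, `1 ≤ j ≤ k` (not supplied by supKey).  The sup key is node N07's content and is NOT proved here.
[cite: Balaban1985Variational, Thm 1 (8)–(10) p.279] -/
theorem capture_run_one_of_supKey {L N : ℕ} (hL : 1 ≤ L) (C : B11Thm1.Consts) {c ε₁ : ℝ} (hε : 0 < ε₁)
    (hεa : ε₁ ≤ C.a₁) (hsmall : 512 * (d + 1) * (d + 4) * (C.B₃ * ε₁) ≤ 1)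
    (hK : ∀ (k : ℕ) (ε₁ : ℝ), 0 < ε₁ → ε₁ ≤ C.a₁ → ∀ (V U : Site d → Fin d → (Matrix n n ℂ)ˣ), V ∈ sfClass d L N ε₁ 0 →
      IsMinimiser d (sfClass d L N (C.B₃ * ε₁)) L N (k + 1) V U →
        ∀ (x : Site d) (κ : Fin d) (π : T4AveragingDeficitWall.Plane d),
          ‖covGrad U (fun q => ((fhol U q : (Matrix n n ℂ)ˣ) : Matrix n n ℂ)) x κ π‖ ≤ c * ε₁ / ((L : ℝ) ^ (k + 1)) ^ 3)
    {V U : Site d → Fin d → (Matrix n n ℂ)ˣ} (hV : V ∈ sfClass d L N ε₁ 0)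
    (hU : IsMinimiser d (sfClass d L N (C.B₃ * ε₁)) L N 1 V U) :
    U ∈ sfClass d L N (ε₁ * (1 + (2 * d + 4) * c)
      + (2 * (2 * d + 4) * (3 * d + 8) + 14464 * (d + 1) ^ 2 * (d + 4) ^ 2) * (C.B₃ * ε₁) ^ 2) 1 := by
  have hmem := hU.mem
  have hcls : U ∈ sfClass d L N (C.B₃ * ε₁) 1 := hmem.1
  have havg : avgIter L U 1 = V := hmem.2
  have hγ := hK 0 ε₁ hε hεa V U hV hU
  simp only [zero_add, pow_one] at hγ
  exact mem_sfClass_one_of_avg hL (by have := C.B₃_pos; positivity) hsmall hcls (havg ▸ hV) hγ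

end

end Summit.QuantumFields.YangMills.BalabanUVNodes.N16CaptureRunOne
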